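import Literature.NumberTheory.EllipticCurves.SelmerCorankProofs
import Literature.NumberTheory.EllipticCurves.SubgroupSelmer
import HarnessLib

/-!
# The EXACT `δ₀` kernel count `#ker(j_* : H¹(G, A) → H¹(G, B)) · #q(B^G) = #C^G` for `0 → A —j→ B —q→ C → 0`
# (explicit cocycles; any topological group `G`, discrete modules), and its two road shapes
# `B^G = 0 ⇒ #ker j_* = #C^G`, `A^G = 0 ⇒ #ker j_* · #B^G = #C^G`
# (cell `bsd-eis`, seat `bsd-line-x1-p1-w4` gen 3, D-0154 WIDTH PASS; crux 2 `GoodLatticeBDPValue`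
# stmt-BirchSwinnertonDyer-19032, line `halves` v19.1, V21 INDEX ROAD inputs «`#ker a = p^ε`» and
# «`#ker a′ · #ker κ′_f = p^s`» of LEAD g4's `FiniteIndexCalculus.zpCorank_add_eq_of_index_inputs`)

HONEST FRAMING (cell `bsd-eis`, run/shared/lean/pub/bsd-eis/): Galois-cohomology bookkeeping for ABSTRACT
discrete modules; no definition, no named fact, no `sorry`, no `Theses` import; nothing about any curve is
asserted; BSD / IMC2 / KY Thm. 1.4.1 are proved for NO curve. Helper `--supports stmt-BirchSwinnertonDyer-19032`.

## Why
The abstract assembly of the V21 road (p642332 / p642849 / `…LambdaIdentityOfIndexInputs`) takes as NUMERICAL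
inputs the orders of the kernels of the residual maps `a : H¹(·, N_ω) → H¹(·, N_f)` — globally `#ker a = p^ε`
(`ε = [𝟙̃|_{G_K} = 𝟙]`) and at each place `w_j ∣ v̄` the «local cancellation» `#ker a′_j · #ker κ′_{f,j} = p`.
Both are the exactness of `B^G →q C^G →δ₀ H¹(G, A) →j_* H¹(G, B)` for the residual sequence
`0 → N_ω → N_f → N_1 → 0` (Serre CG I §2.2 Prop. 2): `ker j_* = im δ₀ ≅ C^G / q(B^G)`. The tree had the
INEQUALITY `#ker j_* ≤ #C^G` (x2-p2 g5's `ResidualDevissageCountSharp.natCard_ker_resH1Hom_id_le_fixedPoints`);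
here the EQUALITY, by the same explicit-cocycle dictionary `[φ] ↦ q(b)` (`j ∘ φ = ∂b`) read in `C^G / q(B^G)`:

* §1 `natCard_ker_resH1Hom_id_mul_natCard_image_fixed_eq` — **`#ker j_* · #q(B^G) = #C^G`** (the map
  `ker j_* → C^G/q(B^G)` is injective without any hypothesis and onto when the orbit maps of `B` are
  continuous, so that `∂b` is a continuous cocycle; `Nat.card`, no finiteness needed).
* §2 the two road shapes: `natCard_ker_resH1Hom_id_eq_of_fixed_eq_zero` (**`B^G = 0 ⇒ #ker j_* = #C^G`**: the
  global row, `N_f^H = E(K_∞)[p] = 0`, `#N_1^H = p^ε`) and `natCard_ker_resH1Hom_id_mul_natCard_fixed_eq`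
  (**`A^G = 0 ⇒ #ker j_* · #B^G = #C^G`**: the local rows at `G_j = ker κ ⊓ D_v̄`, `N_ω^{G_j} = 0` by p643003,
  `N_1^{G_j} = N_1`, to be paired with UTD's `natCard_ker_kummer_eq_natCard_fixed_torsion` `#ker κ′_{f,j} = #E[p]^{G_j}`
  under Fin_v, giving `#ker a′_j · #ker κ′_{f,j} = #N_1 = p` per place).

References: [SerreGaloisCohomology1997] I.§2.2 (Prop. 2) and I.§5.4 (the connecting map `δ`);
[KellerYin2024] proof of Thm. 1.4.1, Lemma 1.4.4 («the map `g` has kernel `𝔽` if `𝟙̃ = 𝟙`», arXiv:2402.12781v2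
TeX L1183–1200) and Cases I–III (the local `H⁰` terms, L1200–1330); [CastellaGrossiLeeSkinner2022] Prop. 17.
-/

set_option autoImplicit false
set_option linter.dupNamespace false -- the summit namespace `…BirchSwinnertonDyer.BirchSwinnertonDyer.Theorems` (Sub = Summit, D-0017) trips it

noncomputable section

open scoped Classical

universe u

namespace Summit.BirchSwinnertonDyer.BirchSwinnertonDyer.Theorems.H1KernelFixedPointCount

open Literature.NumberTheory.EllipticCurves Literature.NumberTheory.GaloisRepresentations

variable {G : Type u} [Group G] [TopologicalSpace G] [IsTopologicalGroup G]
variable {A : Type u} [AddCommGroup A] [DistribMulAction G A] [TopologicalSpace A] [DiscreteTopology A]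
variable {B : Type u} [AddCommGroup B] [DistribMulAction G B] [TopologicalSpace B] [DiscreteTopology B]
variable {C : Type u} [AddCommGroup C] [DistribMulAction G C]

/-! ### §1 `#ker j_* · #q(B^G) = #C^G` -/

omit [TopologicalSpace G] [IsTopologicalGroup G] [TopologicalSpace A] [DiscreteTopology A]
  [TopologicalSpace B] [DiscreteTopology B] in
/-- `q` maps `G`-fixed vectors of `B` to `G`-fixed vectors of `C` (equivariance). [folklore] -/
theorem smul_map_eq_of_forall_smul_eq (q : B →+ C) (hq : ∀ (g : G) (b : B), q (g • b) = g • q b)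
    {b : B} (hb : ∀ g : G, g • b = b) (g : G) : g • q b = q b := by
  rw [← hq, hb]

/-- **Exact `δ₀` kernel count: `#ker(j_* : H¹(G, A) → H¹(G, B)) · #q(B^G) = #C^G`** for an exact sequence
`0 → A —j→ B —q→ C → 0` of discrete `G`-modules (`j` injective, `q` onto, `ker q = im j`; the orbit maps of `B`
continuous). The connecting map `δ₀ : C^G → H¹(G, A)`, `c = q b ↦ [j⁻¹ ∘ ∂b]`, is onto `ker j_*` with kernel
`q(B^G)` (Serre CG I §2.2 Prop. 2 / I §5.4): explicitly, `y ∈ ker j_*` is `[φ]` with `j ∘ φ = ∂b_y`, and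
`y ↦ q(b_y) mod q(B^G)` is a bijection `ker j_* ≃ C^G / q(B^G)`. Here `C^G` is the subgroup of `G`-fixed
vectors and `q(B^G) ≤ C^G` the image of the `G`-fixed vectors of `B`. [cite: SerreGaloisCohomology1997, I.§2.2 (Prop. 2) and I.§5.4] -/
theorem natCard_ker_resH1Hom_id_mul_natCard_image_fixed_eq (j : A →+ B)
    (hj : ∀ (g : G) (a : A), j (ContinuousMonoidHom.id G g • a) = g • j a) (hinj : Function.Injective j)
    (q : B →+ C) (hq : ∀ (g : G) (b : B), q (g • b) = g • q b) (hqj : ∀ a : A, q (j a) = 0)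
    (hexact : ∀ b : B, q b = 0 → ∃ a : A, j a = b) (hsurj : Function.Surjective q)
    (hcont : ∀ b : B, Continuous fun g : G ↦ g • b) :
    Nat.card {y : discreteH1 G A // resH1Hom (ContinuousMonoidHom.id G) j hj y = 0} *
        Nat.card {c : C // ∃ b : B, (∀ g : G, g • b = b) ∧ q b = c} =
      Nat.card {c : C // ∀ g : G, g • c = c} := by
  have hj' : ∀ (g : G) (a : A), j (g • a) = g • j a := hj
  -- the fixed-point group `F = C^G` and the subgroup `I = q(B^G) ≤ F`
  let F : AddSubgroup C :=
    { carrier := {c | ∀ g : G, g • c = c}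
      add_mem' := fun {x y} hx hy g ↦ by rw [smul_add, hx g, hy g]
      zero_mem' := fun g ↦ smul_zero g
      neg_mem' := fun {x} hx g ↦ by rw [smul_neg, hx g] }
  let I : AddSubgroup F :=
    { carrier := {c | ∃ b : B, (∀ g : G, g • b = b) ∧ q b = (c : C)}
      add_mem' := fun {x y} ⟨bx, hbx, hqx⟩ ⟨by_, hby, hqy⟩ ↦
        ⟨bx + by_, fun g ↦ by rw [smul_add, hbx g, hby g], by
          rw [map_add, hqx, hqy]; rfl⟩
      zero_mem' := ⟨0, fun g ↦ smul_zero g, by rw [map_zero]; rfl⟩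
      neg_mem' := fun {x} ⟨bx, hbx, hqx⟩ ↦ ⟨-bx, fun g ↦ by rw [smul_neg, hbx g], by
        rw [map_neg, hqx]; rfl⟩ }
  -- `#F = #(F/I) · #I`, and `#I = #q(B^G)`, `#F = #C^G`
  have hF : Nat.card F = Nat.card {c : C // ∀ g : G, g • c = c} := rfl
  have hI : Nat.card I = Nat.card {c : C // ∃ b : B, (∀ g : G, g • b = b) ∧ q b = c} := by
    refine Nat.card_congr
      { toFun := fun x ↦ ⟨(x.1 : C), x.2⟩
        invFun := fun c ↦ ⟨⟨c.1, by
          obtain ⟨b, hb, hqb⟩ := c.2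
          intro g; rw [← hqb]; exact smul_map_eq_of_forall_smul_eq q hq hb g⟩, c.2⟩
        left_inv := fun x ↦ by rfl
        right_inv := fun c ↦ by rfl }
  rw [← hF, ← hI, AddSubgroup.card_eq_card_quotient_mul_card_addSubgroup I]
  congr 1
  -- the bijection `ker j_* ≃ F/I`
  -- representatives: `y = [φ y]` with `j ∘ φ y = ∂(b y)`
  have hrep : ∀ y : {y : discreteH1 G A // resH1Hom (ContinuousMonoidHom.id G) j hj y = 0},
      ∃ φ : contOneCocycles (discreteTopRep G A), ∃ b : B,
        oneCocycleClass _ φ = y.1 ∧ ∀ g : G, j (φ.1 g) = g • b - b := by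
    intro y
    obtain ⟨φ, hφ⟩ := oneCocycleClass_surjective _ y.1
    have h0 := y.2
    rw [← hφ, resH1Hom_id_oneCocycleClass, oneCocycleClass_eq_zero_iff] at h0
    obtain ⟨b, hb⟩ := h0
    exact ⟨φ, b, hφ, fun g ↦ hb g⟩
  choose φ b hφ hb using hrep
  have hfix : ∀ y, ∀ g : G, g • q (b y) = q (b y) := fun y g ↦ by
    rw [← hq, ← sub_eq_zero, ← map_sub, ← hb, hqj]
  let Φ : {y : discreteH1 G A // resH1Hom (ContinuousMonoidHom.id G) j hj y = 0} → F ⧸ I :=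
    fun y ↦ QuotientAddGroup.mk (⟨q (b y), hfix y⟩ : F)
  refine Nat.card_congr (Equiv.ofBijective Φ ⟨?_, ?_⟩)
  · -- injective: `q(b y) - q(b y') = q b₀`, `b₀ ∈ B^G` ⟹ `b y - b y' - b₀ = j a₀` ⟹ `φ y - φ y' = ∂a₀`
    intro y y' h
    have h' : (⟨q (b y), hfix y⟩ : F) - ⟨q (b y'), hfix y'⟩ ∈ I := by
      rw [← QuotientAddGroup.eq_iff_sub_mem]
      exact h
    obtain ⟨b₀, hb₀, hqb₀⟩ := h'
    have hqb₀' : q b₀ = q (b y) - q (b y') := hqb₀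
    have hq0 : q (b y - b y' - b₀) = 0 := by rw [map_sub, map_sub, hqb₀', sub_self]
    obtain ⟨a₀, ha₀⟩ := hexact _ hq0
    apply Subtype.ext
    rw [← hφ y, ← hφ y', ← sub_eq_zero, ← oneCocycleClass_sub, oneCocycleClass_eq_zero_iff]
    refine ⟨a₀, fun g ↦ hinj ?_⟩
    change j ((φ y - φ y').1 g) = j ((discreteTopRep G A).ρ g a₀ - a₀)
    change j (((φ y).1 - (φ y').1) g) = j (g • a₀ - a₀)
    rw [ContinuousMap.sub_apply, map_sub, hb, hb, map_sub, hj', ha₀, smul_sub, smul_sub, hb₀ g]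
    abel
  · -- surjective: for `c ∈ C^G`, `c = q b₀`, the coboundary `∂b₀` is `ker q = j(A)`-valued, hence `j ∘ ψ`
    intro x
    obtain ⟨c, rfl⟩ := QuotientAddGroup.mk_surjective x
    obtain ⟨b₀, hb₀⟩ := hsurj (c : C)
    -- the principal cocycle of `b₀`
    let π : contOneCocycles (discreteTopRep G B) :=
      ⟨⟨fun g ↦ g • b₀ - b₀, (hcont b₀).sub continuous_const⟩, fun g h ↦ by
        change (g * h) • b₀ - b₀ = (g • b₀ - b₀) + g • (h • b₀ - b₀)
        rw [mul_smul, smul_sub]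
        abel⟩
    have hπ : ∀ g : G, ∃ a : A, j a = π.1 g := fun g ↦ hexact _ (by
      change q (g • b₀ - b₀) = 0
      rw [map_sub, hq, hb₀, c.2 g, sub_self])
    choose s hs using hπ
    let ψ := contOneCocycles.lift j hj hinj π s hs
    have hψker : resH1Hom (ContinuousMonoidHom.id G) j hj (oneCocycleClass _ ψ) = 0 := by
      rw [resH1Hom_id_oneCocycleClass, contOneCocycles.push_lift]
      exact (oneCocycleClass_eq_zero_iff _ π).mpr ⟨b₀, fun g ↦ rfl⟩
    refine ⟨⟨oneCocycleClass _ ψ, hψker⟩, ?_⟩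
    -- `Φ` of this class is `q(b …) ≡ q b₀ = c` modulo `I`: `b … - b₀ ∈ B^G + j(A)`
    set y : {y : discreteH1 G A // resH1Hom (ContinuousMonoidHom.id G) j hj y = 0} :=
      ⟨oneCocycleClass _ ψ, hψker⟩ with hydef
    change QuotientAddGroup.mk (⟨q (b y), hfix y⟩ : F) = QuotientAddGroup.mk c
    rw [QuotientAddGroup.eq_iff_sub_mem]
    -- `[φ y] = [ψ]`, so `φ y - ψ = ∂a₁`; then `∂(b y) = j ∘ φ y = j ∘ ψ + j ∘ ∂a₁ = ∂b₀ + ∂(j a₁)`,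
    -- i.e. `b y - b₀ - j a₁ ∈ B^G`, and `q` of it is `q(b y) - c`
    have hcl : oneCocycleClass _ (φ y) = oneCocycleClass _ ψ := hφ y
    rw [← sub_eq_zero, ← oneCocycleClass_sub, oneCocycleClass_eq_zero_iff] at hcl
    obtain ⟨a₁, ha₁⟩ := hcl
    have ha₁' : ∀ g : G, (φ y).1 g - ψ.1 g = g • a₁ - a₁ := fun g ↦ ha₁ g
    refine ⟨b y - b₀ - j a₁, fun g ↦ ?_, ?_⟩
    · have e1 : j ((φ y).1 g) = g • b y - b y := hb y g
      have e2 : j (ψ.1 g) = g • b₀ - b₀ := hs g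
      have e3 : j ((φ y).1 g) - j (ψ.1 g) = j (g • a₁) - j a₁ := by
        rw [← map_sub, ha₁', map_sub]
      rw [hj'] at e3
      -- from `e1`, `e2`, `e3`: `g • b y - b y - (g • b₀ - b₀) = g • j a₁ - j a₁`
      have e4 : g • b y - b y - (g • b₀ - b₀) = g • j a₁ - j a₁ := by rw [← e1, ← e2, e3]
      calc g • (b y - b₀ - j a₁)
          = (g • b y - b y - (g • b₀ - b₀)) - (g • j a₁ - j a₁) + (b y - b₀ - j a₁) := by
            rw [smul_sub, smul_sub]; abel
        _ = b y - b₀ - j a₁ := by rw [e4, sub_self, zero_add]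
    · change q (b y - b₀ - j a₁) = ((⟨q (b y), hfix y⟩ : F) - c : F)
      rw [map_sub, map_sub, hqj, sub_zero, hb₀]
      rfl

/-! ### §2 The two road shapes -/

/-- **`B^G = 0 ⇒ #ker(j_* : H¹(G, A) → H¹(G, B)) = #C^G`** (then `q(B^G) = 0`): the GLOBAL row of the V21
road — `N_f^H = E(K_∞)[p] = 0`, so `#ker(H¹(H, 𝔽(ω̃)) → H¹(H, E_K[p])) = #𝔽(𝟙̃)^H = p^ε`, `ε = [𝟙̃|_{G_K} = 𝟙]`
(KY Lemma 1.4.4: «`g` is injective if `𝟙̃ ≠ 𝟙` and has kernel `𝔽` if `𝟙̃ = 𝟙`»).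
[cite: KellerYin2024, Lemma 1.4.4 (arXiv:2402.12781v2 TeX L1183–1200)] [cite: SerreGaloisCohomology1997, I.§2.2 (Prop. 2)] -/
theorem natCard_ker_resH1Hom_id_eq_of_fixed_eq_zero (j : A →+ B)
    (hj : ∀ (g : G) (a : A), j (ContinuousMonoidHom.id G g • a) = g • j a) (hinj : Function.Injective j)
    (q : B →+ C) (hq : ∀ (g : G) (b : B), q (g • b) = g • q b) (hqj : ∀ a : A, q (j a) = 0)
    (hexact : ∀ b : B, q b = 0 → ∃ a : A, j a = b) (hsurj : Function.Surjective q)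
    (hcont : ∀ b : B, Continuous fun g : G ↦ g • b)
    (hB : ∀ b : B, (∀ g : G, g • b = b) → b = 0) :
    Nat.card {y : discreteH1 G A // resH1Hom (ContinuousMonoidHom.id G) j hj y = 0} =
      Nat.card {c : C // ∀ g : G, g • c = c} := by
  have h := natCard_ker_resH1Hom_id_mul_natCard_image_fixed_eq j hj hinj q hq hqj hexact hsurj hcont
  have h1 : Nat.card {c : C // ∃ b : B, (∀ g : G, g • b = b) ∧ q b = c} = 1 := by
    rw [Nat.card_eq_one_iff_unique]
    refine ⟨⟨fun x x' ↦ Subtype.ext ?_⟩, ⟨⟨0, 0, fun g ↦ smul_zero g, map_zero q⟩⟩⟩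
    obtain ⟨bx, hbx, hqx⟩ := x.2
    obtain ⟨bx', hbx', hqx'⟩ := x'.2
    rw [← hqx, ← hqx', hB bx hbx, hB bx' hbx']
  rwa [h1, mul_one] at h

/-- **`A^G = 0 ⇒ #ker(j_* : H¹(G, A) → H¹(G, B)) · #B^G = #C^G`** (then `q|_{B^G}` is injective, so
`#q(B^G) = #B^G`): the LOCAL rows of the V21 road at `G_j = ker κ ⊓ D_v̄` — `𝔽(ω̃)^{G_j} = 0` (p643003), so
`#ker a′_j · #E_K[p]^{G_j} = #𝔽(𝟙̃)^{G_j} = p`, which with `#ker κ′_{f,j} = #E_K[p]^{G_j}` (Fin_v, UTD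
`natCard_ker_kummer_eq_natCard_fixed_torsion`) is the local cancellation `#ker a′_j · #ker κ′_{f,j} = p`
(KY Cases I–III collapse). [cite: KellerYin2024, proof of Thm. 1.4.1, Cases I–III (arXiv:2402.12781v2 TeX L1200–1330)]
[cite: SerreGaloisCohomology1997, I.§2.2 (Prop. 2)] -/
theorem natCard_ker_resH1Hom_id_mul_natCard_fixed_eq (j : A →+ B)
    (hj : ∀ (g : G) (a : A), j (ContinuousMonoidHom.id G g • a) = g • j a) (hinj : Function.Injective j)
    (q : B →+ C) (hq : ∀ (g : G) (b : B), q (g • b) = g • q b) (hqj : ∀ a : A, q (j a) = 0)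
    (hexact : ∀ b : B, q b = 0 → ∃ a : A, j a = b) (hsurj : Function.Surjective q)
    (hcont : ∀ b : B, Continuous fun g : G ↦ g • b)
    (hA : ∀ a : A, (∀ g : G, g • a = a) → a = 0) :
    Nat.card {y : discreteH1 G A // resH1Hom (ContinuousMonoidHom.id G) j hj y = 0} *
        Nat.card {b : B // ∀ g : G, g • b = b} =
      Nat.card {c : C // ∀ g : G, g • c = c} := by
  have hj' : ∀ (g : G) (a : A), j (g • a) = g • j a := hj
  have h := natCard_ker_resH1Hom_id_mul_natCard_image_fixed_eq j hj hinj q hq hqj hexact hsurj hcont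
  -- `q|_{B^G}` is injective since `ker q ∩ B^G = j(A^G) = 0`
  have hqinj : ∀ b b' : B, (∀ g : G, g • b = b) → (∀ g : G, g • b' = b') → q b = q b' → b = b' := by
    intro b b' hb hb' hqb
    obtain ⟨a, ha⟩ := hexact (b - b') (by rw [map_sub, hqb, sub_self])
    have hafix : ∀ g : G, g • a = a := fun g ↦ hinj (by rw [hj', ha, smul_sub, hb g, hb' g])
    have ha0 : a = 0 := hA a hafix
    rw [ha0, map_zero] at ha
    exact (sub_eq_zero.mp ha.symm)
  have h2 : Nat.card {c : C // ∃ b : B, (∀ g : G, g • b = b) ∧ q b = c} =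
      Nat.card {b : B // ∀ g : G, g • b = b} := by
    symm
    refine Nat.card_eq_of_bijective (fun b ↦ ⟨q b.1, b.1, b.2, rfl⟩) ⟨fun b b' hbb' ↦ ?_, fun c ↦ ?_⟩
    · exact Subtype.ext (hqinj _ _ b.2 b'.2 (congrArg Subtype.val hbb'))
    · obtain ⟨b, hb, hqb⟩ := c.2
      exact ⟨⟨b, hb⟩, Subtype.ext hqb⟩
  rwa [h2] at h

end Summit.BirchSwinnertonDyer.BirchSwinnertonDyer.Theorems.H1KernelFixedPointCount

end
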